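import Mathlib
import Summits.ValiantsHypothesis.ValiantsHypothesis.Theses.ValuativeGCT
import Literature.Computability.AlgebraicComplexity.OrbitClosureWeights
import Summits.ValiantsHypothesis.ValiantsHypothesis.Theorems.ValuativeGCTValuativeBound
import Summits.ValiantsHypothesis.ValiantsHypothesis.Theorems.ValuativeGCTValuativeFlipStabInvLeExplicit
import Summits.ValiantsHypothesis.ValiantsHypothesis.Theorems.ValuativeGCTHeadFlipFourRowBridge

/-!
# Det-orbit-closure multiplicity obstruction from the four-row gap (line `four-row-count`)

Crux `ValuativeGCT.ValuativeFlip` (stmt-ValiantsHypothesis-12624), line `four-row-count`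
(`Cruxes/ValuativeFlip/Lines/four_row_count.lean`).  The line's stub 4, `stub_fourRowBridge` (the
`GL₄`-equivariant bridge from a total dimension gap between the two four-row modules to a crux-weight
witness), is a theorem of the tree: `HeadFlip.stub_fourRowBridge`
(`Theorems/ValuativeGCTHeadFlipFourRowBridge.lean`, child crux `ValuativeGCT.HeadFlip`, verbatim the same
statement), assembled over the block-embedding / per-side infrastructure of
`…ValuativeFlipFourRowBridgeBlock`, `…ValuativeFlipFourRowBridgePer` (and, abstractly,
`…ValuativeFlipFourRowBridgeCore.frb_bridge_core`).

This file records the DET-ORBIT-CLOSURE MULTIPLICITY reading of the bridge: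
`fourRow_detOrbitMultiplicity_lt_of_gap` — under the same gap hypothesis some `λ ⊢ mδ` with `ℓ(λ) ≤ 4` is a
genuine Mulmuley–Sohoni multiplicity obstruction, `K_m(λ*) = mult_{λ*} ℂ[Δ(det_m)] < mult_{λ*} ℂ[Δ_m(X₀₀^{m-n} per_n)]`,
because `K_m(λ*) ≤ dim T_⊤(λ)` (the landed valuative bound `ValuativeBound_proof` at the trivial centre
`U = ⊤`, `r = m`, where the valuative clause is vacuous) and `T_⊤(λ) ≤ Hom_{mδ} ⊓ SAND ⊓ HWSP(λ*)`
(`stub_stabInv_le_explicit`).  So once the per-side stubs of the head (`stub_fourRowPencilRank`,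
`stub_fourRowHilbertLowerBound`) land, every head position `n ≤ m ≤ 1.2 n` carries a multiplicity
obstruction for `det_m` versus `X₀₀^{m-n} per_n` on a four-row shape.
Mulmuley–Sohoni 2008 (multiplicity obstructions); BLMW 2011 §5.2. [folklore]
-/

-- `Summit.ValiantsHypothesis.ValiantsHypothesis.…` is the tree's mandated single-conjunct layout (Sub = Summit).
set_option linter.dupNamespace false

namespace Summit.ValiantsHypothesis.ValiantsHypothesis.Theorems.ValuativeFlip

open MvPolynomial
open scoped BigOperators Matrix
open Literature.NumberTheory.DiophantineGeometry
open Literature.Computability.AlgebraicComplexity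

noncomputable section

/-- **Det-orbit-closure multiplicity obstruction from the four-row gap.**  Under the gap hypothesis of
`stub_fourRowBridge` (the four-row det-side module `Hom_{mδ} ⊓ SAND ⊓ ROWS₄` is smaller than the four-row
per-side image `Φ(Hom_δ ⊓ SUPP₄)`, `Φ = genericOrbitMap (X₀₀^{m-n} per_n) m`), some partition `λ ⊢ mδ` with
at most four rows is a multiplicity obstruction in the sense of Mulmuley–Sohoni: the multiplicity
`K_m(λ*)` of `λ*` in the coordinate ring of the orbit closure of `det_m` is STRICTLY smaller than its
multiplicity in that of `X₀₀^{m-n} per_n`.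
Proof: `K_m(λ*) ≤ dim T_⊤(λ)` (`ValuativeBound_proof` at `U = ⊤`, `r = m`: every `m × m` matrix has rank
`≤ m`, and the valuative clause `I(L_⊤)^{δ(m-m)} = ⊤` is vacuous) `≤ dim (Hom_{mδ} ⊓ SAND ⊓ HWSP(λ*))`
(`T_⊤ ≤ Hom ⊓ STABINV ⊓ HWSP` and `STABINV ≤ SAND`, `stub_stabInv_le_explicit`)
`< mult_{λ*} ℂ[Δ_m(X₀₀^{m-n} per_n)]` (`HeadFlip.stub_fourRowBridge`).
Mulmuley–Sohoni 2008; BLMW 2011 §5.2 (Prop. 5.2.1 is the case `U = 0`). [folklore] -/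
theorem fourRow_detOrbitMultiplicity_lt_of_gap :
    ∀ (n m : ℕ) [NeZero m] (δ : ℕ), n ≤ m → 2 ≤ m →
      Module.finrank ℂ ↥(MvPolynomial.homogeneousSubmodule (MatIdx m × MatIdx m) ℂ (m * δ) ⊓
        (⨅ (P : Matrix (Fin m) (Fin m) ℂ) (Q : Matrix (Fin m) (Fin m) ℂ) (_ : P.det = 1) (_ : Q.det = 1), LinearMap.ker ((MvPolynomial.aeval fun p : MatIdx m × MatIdx m => ∑ l : MatIdx m, (P (ofLex p.2).1 (ofLex l).1 * Q (ofLex l).2 (ofLex p.2).2) • (MvPolynomial.X (p.1, l) : MvPolynomial (MatIdx m × MatIdx m) ℂ)).toLinearMap - (LinearMap.id : MvPolynomial (MatIdx m × MatIdx m) ℂ →ₗ[ℂ] MvPolynomial (MatIdx m × MatIdx m) ℂ))) ⊓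
        Subalgebra.toSubmodule (MvPolynomial.supported ℂ {p : MatIdx m × MatIdx m | m * m ≤ (((matIdxEquiv m).symm p.1 : Fin (m * m)) : ℕ) + 4})) <
      Module.finrank ℂ ↥(((MvPolynomial.homogeneousSubmodule (DegIdx (MatIdx m) m) ℂ δ ⊓ Subalgebra.toSubmodule (MvPolynomial.supported ℂ {d : DegIdx (MatIdx m) m | ∀ i : MatIdx m, ¬ (m * m ≤ (((matIdxEquiv m).symm i : Fin (m * m)) : ℕ) + 4) → d.1 i = 0})).map (genericOrbitMap (paddedPerFormLex ℂ n m) m).toLinearMap)) →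
      ∃ lam : Nat.Partition (m * δ), lam.parts.card ≤ 4 ∧
        orbitMultiplicity ℂ (detFormLex ℂ m) m ((Weight.dualOfPartition (m * m) lam).toMatIdx : Weight (MatIdx m)) <
        orbitMultiplicity ℂ (paddedPerFormLex ℂ n m) m ((Weight.dualOfPartition (m * m) lam).toMatIdx : Weight (MatIdx m)) := by
  intro n m _ δ hnm hm2 hgap
  obtain ⟨lam, hlam4, hlt⟩ :=
    Summit.ValiantsHypothesis.ValiantsHypothesis.Theorems.HeadFlip.stub_fourRowBridge n m δ hnm hm2 hgap
  refine ⟨lam, hlam4, lt_of_le_of_lt ?_ hlt⟩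
  have hlamN : lam.parts.card ≤ m * m := hlam4.trans (by nlinarith)
  have hVB := Summit.ValiantsHypothesis.ValiantsHypothesis.Theorems.ValuativeBound.ValuativeBound_proof m ⊤ m
    (fun u _ => (Matrix.rank_le_width _)) δ lam hlamN
  dsimp only at hVB
  haveI : Module.Finite ℂ ↥(MvPolynomial.homogeneousSubmodule (MatIdx m × MatIdx m) ℂ (m * δ)) :=
    finite_homogeneousSubmodule _ _ _
  refine hVB.trans (Submodule.finrank_mono ?_)
  exact inf_le_inf (le_inf (inf_le_left.trans inf_le_left)
    (inf_le_right.trans ((stub_stabInv_le_explicit m).trans inf_le_left))) le_rfl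

end

end Summit.ValiantsHypothesis.ValiantsHypothesis.Theorems.ValuativeFlip
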